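import Mathlib
import HarnessLib

/-!
# A witness group for Higman's relations (amalgamated products in `Perm ℚ`)

Topic `Literature/GroupTheory/CombinatorialGroupTheory`.  Used by `HigmanGroup.lean` to prove that
Higman's group `⟨a₀,a₁,a₂,a₃ ∣ aᵢ₊₁⁻¹aᵢaᵢ₊₁ = aᵢ²⟩` is non-trivial.

Higman (1951, §2) shows that his group is an iterated free product with amalgamation, hence
infinite.  We formalise exactly what consumers need — a group `W` and elements `A, B, C, D ∈ W`
satisfying the four relations with `A ≠ 1` (`HigmanGroup.exists_witness`) — using Mathlib's
amalgamated product `Monoid.PushoutI` and its reduced-word theorem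
(`Monoid.PushoutI.Reduced.eq_empty_of_mem_range`):

* the affine maps `x = (t ↦ t + 1)`, `y = (t ↦ t/2)` of `ℚ` satisfy `y⁻¹ x y = x²` (a copy of the
  Baumslag–Solitar group `BS(1,2)` inside `Equiv.Perm ℚ`), and `xᵐ = yⁿ` only for `m = n = 0`;
* `L s = Perm ℚ ∗_ℤ Perm ℚ` (two gluing patterns `s : Bool`) contains `a, b, c` with `b⁻¹ab = a²`,
  `c⁻¹bc = b²`, and the subgroup generated by `a` and `c` is free: the natural map `ψ s` from the free
  product `ℤ ∗ ℤ` is injective (`HigmanGroup.ψ_injective`), by the reduced-word theorem;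
* `W = L₀ ∗_{ℤ∗ℤ} L₁` then contains the required `A, B, C, D`, and `A ≠ 1` because factors embed in
  amalgamated products over injective maps (`Monoid.PushoutI.of_injective`).

Sources: G. Higman, *A finitely generated infinite simple group*, J. London Math. Soc. 26 (1951)
61–64, §2; J.-P. Serre, *Trees*, I.1.4.  Design: `import Mathlib` (the construction touches `Perm ℚ`,
ordered fields, `PushoutI`, `CoprodI`); everything is `noncomputable` and classical (reduced words of
`PushoutI` need decidable equality on `Perm ℚ`).
-/

noncomputable section

open scoped Classical

namespace Literature.GroupTheory.CombinatorialGroupTheory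

namespace HigmanGroup

open Monoid Equiv

/-! ## `BS(1,2)` inside `Perm ℚ` -/

/-- Translation `t ↦ t + 1` of `ℚ`. [folklore] -/
def px : Perm ℚ := Equiv.addRight (1 : ℚ)

/-- The unit `1/2 ∈ ℚˣ`. [folklore] -/
def uhalf : ℚˣ := Units.mk0 (2⁻¹ : ℚ) (by norm_num)

/-- Scaling `t ↦ t/2` of `ℚ` (as the permutation action of the unit `1/2`). [folklore] -/
def py : Perm ℚ := MulAction.toPermHom ℚˣ ℚ uhalf

/-- Powers of the translation: `xᵐ(t) = t + m`. [folklore] -/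
@[simp] theorem px_zpow_apply (m : ℤ) (t : ℚ) : (px ^ m) t = t + m := by
  simp [px, zsmul_eq_mul]

/-- Powers of the scaling: `yⁿ(t) = 2⁻ⁿ t`. [folklore] -/
@[simp] theorem py_zpow_apply (n : ℤ) (t : ℚ) : (py ^ n) t = ((uhalf ^ n : ℚˣ) : ℚ) * t := by
  rw [py, ← map_zpow, MulAction.toPermHom_apply, MulAction.toPerm_apply, Units.smul_def, smul_eq_mul]

/-- The Baumslag–Solitar relation `y⁻¹ x y = x²` for `x = (t ↦ t+1)`, `y = (t ↦ t/2)`. [folklore] -/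
theorem py_inv_mul_px_mul_py : py⁻¹ * px * py = px ^ 2 := by
  ext t
  have h2 : ((uhalf ^ (1 : ℤ) : ℚˣ) : ℚ) = 2⁻¹ := by simp [uhalf]
  have h2' : ((uhalf ^ (-1 : ℤ) : ℚˣ) : ℚ) = 2 := by simp [uhalf]
  have e1 : (py⁻¹ * px * py) t = (py ^ (-1 : ℤ)) ((px ^ (1 : ℤ)) ((py ^ (1 : ℤ)) t)) := by
    simp [Perm.mul_apply]
  rw [e1, py_zpow_apply, px_zpow_apply, py_zpow_apply, h2, h2',
    show (px ^ 2 : Perm ℚ) = px ^ (2 : ℤ) from (zpow_natCast px 2).symm, px_zpow_apply]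
  push_cast
  ring

/-- `xᵐ = yⁿ` forces `m = 0`: evaluate at `0`. [folklore] -/
theorem eq_zero_of_px_zpow_eq_py_zpow {m n : ℤ} (h : px ^ m = py ^ n) : m = 0 := by
  have := congrArg (fun σ : Perm ℚ => σ 0) h
  simp only [px_zpow_apply, py_zpow_apply, zero_add, mul_zero] at this
  exact_mod_cast this

/-- `y` has infinite order. [folklore] -/
theorem not_isOfFinOrder_py : ¬ IsOfFinOrder py := by
  rw [isOfFinOrder_iff_pow_eq_one]
  rintro ⟨n, hn, h1⟩
  have := congrArg (fun σ : Perm ℚ => σ 1) h1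
  simp only [Perm.one_apply] at this
  rw [← zpow_natCast, py_zpow_apply, mul_one, zpow_natCast] at this
  have hlt : ((uhalf ^ n : ℚˣ) : ℚ) < 1 := by
    rw [Units.val_pow_eq_pow_val]
    exact pow_lt_one₀ (by simp [uhalf]) (by norm_num [uhalf]) hn.ne'
  exact absurd this (ne_of_lt hlt)

/-- `x` has infinite order. [folklore] -/
theorem not_isOfFinOrder_px : ¬ IsOfFinOrder px := by
  rw [isOfFinOrder_iff_pow_eq_one]
  rintro ⟨n, hn, h1⟩
  have := congrArg (fun σ : Perm ℚ => σ 0) h1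
  simp only [Perm.one_apply] at this
  rw [← zpow_natCast, px_zpow_apply, zero_add] at this
  have : (n : ℤ) = 0 := by exact_mod_cast this
  omega

/-- `xᵐ = yⁿ` forces `m = 0` and `n = 0`. [folklore] -/
theorem px_zpow_eq_py_zpow {m n : ℤ} (h : px ^ m = py ^ n) : m = 0 ∧ n = 0 := by
  have hm := eq_zero_of_px_zpow_eq_py_zpow h
  subst hm
  refine ⟨rfl, ?_⟩
  rw [zpow_zero] at h
  have hinj := injective_zpow_iff_not_isOfFinOrder.mpr not_isOfFinOrder_py
  exact (hinj (h.symm.trans (zpow_zero py).symm))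

/-! ## The amalgams `L s = Perm ℚ ∗_ℤ Perm ℚ` -/

/-- Gluing element of factor `i` in pattern `s`: the copy of `ℤ` is glued along powers of `y` or of `x`.
[folklore] -/
def glue (s i : Bool) : Perm ℚ := if s = i then py else px

/-- Free letter of factor `i` in pattern `s` (the other one of `x`, `y`). [folklore] -/
def letter (s i : Bool) : Perm ℚ := if s = i then px else py

/-- The gluing maps `ℤ → Perm ℚ`, `n ↦ (glue s i)ⁿ`. [folklore] -/
def φ (s i : Bool) : Multiplicative ℤ →* Perm ℚ := zpowersHom (Perm ℚ) (glue s i)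

/-- `φ s i n = (glue s i)ⁿ`. [folklore] -/
theorem φ_apply (s i : Bool) (n : Multiplicative ℤ) : φ s i n = glue s i ^ n.toAdd := rfl

/-- The gluing maps are injective (`x`, `y` have infinite order). [folklore] -/
theorem φ_injective (s i : Bool) : Function.Injective (φ s i) := by
  intro m n h
  rw [φ_apply, φ_apply] at h
  have hne : ¬ IsOfFinOrder (glue s i) := by
    unfold glue; split_ifs
    · exact not_isOfFinOrder_py
    · exact not_isOfFinOrder_px
  exact Multiplicative.toAdd.injective (injective_zpow_iff_not_isOfFinOrder.mpr hne h)

/-- A non-zero power of the free letter never lies in the glued copy of `ℤ`. [folklore] -/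
theorem letter_zpow_not_mem_range {s i : Bool} {n : ℤ} (hn : n ≠ 0) :
    letter s i ^ n ∉ (φ s i).range := by
  rintro ⟨m, hm⟩
  rw [φ_apply] at hm
  unfold glue letter at hm
  split_ifs at hm
  · exact hn (px_zpow_eq_py_zpow hm.symm).1
  · exact hn (px_zpow_eq_py_zpow hm).2

/-- The amalgam `L s = Perm ℚ ∗_ℤ Perm ℚ` with gluing pattern `s`. [cite: Higman1951, §2] -/
abbrev L (s : Bool) : Type := PushoutI (φ s)

/-- The free letters `a = letter s false`, `c = letter s true` as elements of `L s`. [cite: Higman1951, §2] -/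
def gen (s i : Bool) : L s := PushoutI.of (φ := φ s) i (letter s i)

/-- The free product `ℤ ∗ ℤ` (a free group of rank two) used as the amalgamated subgroup of `W`. [folklore] -/
abbrev F2 : Type := CoprodI (fun _ : Bool => Multiplicative ℤ)

/-- `ψ s : ℤ ∗ ℤ → L s`, the `i`-th copy of `ℤ` going to powers of the free letter `gen s i`.
[cite: Higman1951, §2] -/
def ψ (s : Bool) : F2 →* L s :=
  CoprodI.lift fun i => zpowersHom (L s) (gen s i)

/-- `ψ s` on the `i`-th copy of `ℤ`. [folklore] -/
theorem ψ_of (s i : Bool) (n : Multiplicative ℤ) :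
    ψ s (CoprodI.of (M := fun _ : Bool => Multiplicative ℤ) (i := i) n) = gen s i ^ n.toAdd := by
  simp [ψ]

/-- Transport of a reduced word of `ℤ ∗ ℤ` to a word in the letters `(letter s i)ⁿ` of the factors of
`L s`. [folklore] -/
def transport (s : Bool) (w : CoprodI.Word (fun _ : Bool => Multiplicative ℤ)) :
    CoprodI.Word (fun _ : Bool => Perm ℚ) where
  toList := w.toList.map fun l => ⟨l.1, letter s l.1 ^ (Multiplicative.toAdd l.2)⟩
  ne_one := by
    intro l hl
    rw [List.mem_map] at hl
    obtain ⟨l', hl', rfl⟩ := hl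
    have h1 : Multiplicative.toAdd l'.2 ≠ 0 := by
      have := w.ne_one l' hl'
      simpa using this
    intro h0
    apply letter_zpow_not_mem_range (s := s) (i := l'.1) h1
    simp only at h0
    rw [h0]
    exact one_mem _
  chain_ne := by
    have := w.chain_ne
    exact List.isChain_map_of_isChain (fun l : (Σ _ : Bool, Multiplicative ℤ) =>
      (⟨l.1, letter s l.1 ^ (Multiplicative.toAdd l.2)⟩ : Σ _ : Bool, Perm ℚ)) (fun _ _ h => h) this

/-- The transported word is reduced for the amalgam `L s`. [folklore] -/
theorem transport_reduced (s : Bool) (w : CoprodI.Word (fun _ : Bool => Multiplicative ℤ)) :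
    PushoutI.Reduced (φ s) (transport s w) := by
  intro l hl
  simp only [transport, List.mem_map] at hl
  obtain ⟨l', hl', rfl⟩ := hl
  have h1 : Multiplicative.toAdd l'.2 ≠ 0 := by
    have := w.ne_one l' hl'
    simpa using this
  exact letter_zpow_not_mem_range h1

/-- The transported word multiplies out to `ψ s` of the original word. [folklore] -/
theorem ofCoprodI_prod_transport (s : Bool) (w : CoprodI.Word (fun _ : Bool => Multiplicative ℤ)) :
    PushoutI.ofCoprodI (transport s w).prod = ψ s w.prod := by
  simp only [CoprodI.Word.prod, transport, map_list_prod, List.map_map]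
  congr 1
  apply List.map_congr_left
  intro l _
  simp only [Function.comp_apply, PushoutI.ofCoprodI_of, ψ_of, gen, map_zpow]

/-- **The subgroup `⟨a, c⟩ ≤ L s` is free**: `ψ s : ℤ ∗ ℤ → L s` is injective (reduced words in the
amalgam). [cite: Higman1951, §2] -/
theorem ψ_injective (s : Bool) : Function.Injective (ψ s) := by
  rw [injective_iff_map_eq_one]
  intro g hg
  set w := CoprodI.Word.equiv g with hw
  have hwg : w.prod = g := CoprodI.Word.equiv.symm_apply_apply g
  have hred := transport_reduced s w
  have hmem : PushoutI.ofCoprodI (transport s w).prod ∈ (PushoutI.base (φ s)).range := by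
    rw [ofCoprodI_prod_transport, hwg, hg]
    exact one_mem _
  have hempty := hred.eq_empty_of_mem_range (φ_injective s) hmem
  have hnil : w.toList = [] := by
    have := congrArg CoprodI.Word.toList hempty
    simpa [transport] using this
  have hw' : w = CoprodI.Word.empty := CoprodI.Word.ext hnil
  rw [← hwg, hw', CoprodI.Word.prod_empty]

/-! ## The witness group `W = L₀ ∗_{ℤ∗ℤ} L₁` -/

/-- The amalgam of the two patterns along the free subgroups `⟨a, c⟩`. [cite: Higman1951, §2] -/
abbrev W : Type := PushoutI (ι := Bool) (G := fun s => L s) ψ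

/-- The factor embeddings `L s → W` are injective. [folklore] -/
theorem of_L_injective (s : Bool) : Function.Injective (PushoutI.of (φ := ψ) s : L s →* W) :=
  PushoutI.of_injective ψ_injective s

/-- The BS relation inside a factor of `L s`: `of i (y⁻¹ x y) = of i (x²)`. [folklore] -/
theorem of_conj (s i : Bool) :
    (PushoutI.of (φ := φ s) i py)⁻¹ * PushoutI.of (φ := φ s) i px * PushoutI.of (φ := φ s) i py =
      PushoutI.of (φ := φ s) i px ^ 2 := by
  rw [← map_inv, ← map_mul, ← map_mul, py_inv_mul_px_mul_py, map_pow]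

/-- The glued element of `L s`: `of false (glue s false) = of true (glue s true)`. [folklore] -/
theorem of_glue_eq (s : Bool) :
    PushoutI.of (φ := φ s) false (glue s false) = PushoutI.of (φ := φ s) true (glue s true) := by
  have h0 : glue s false = φ s false (Multiplicative.ofAdd 1) := by simp [φ_apply]
  have h1 : glue s true = φ s true (Multiplicative.ofAdd 1) := by simp [φ_apply]
  rw [h0, h1, PushoutI.of_apply_eq_base, PushoutI.of_apply_eq_base]

/-- **Witness.** There are a group and four elements `A, B, C, D` with `B⁻¹AB = A²`, `C⁻¹BC = B²`,
`D⁻¹CD = C²`, `A⁻¹DA = D²` and `A ≠ 1` (Higman 1951, §2). [cite: Higman1951, §2] -/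
theorem exists_witness : ∃ (A B C D : W), B⁻¹ * A * B = A ^ 2 ∧ C⁻¹ * B * C = B ^ 2 ∧
    D⁻¹ * C * D = C ^ 2 ∧ A⁻¹ * D * A = D ^ 2 ∧ A ≠ 1 := by
  -- pattern `false`: a = of false x, b = of false y = of true x, c = of true y
  -- pattern `true` : a' = of false y, d = of false x = of true y, c' = of true x
  let ιW : (s : Bool) → L s →* W := fun s => PushoutI.of (φ := ψ) s
  let oL : (s i : Bool) → Perm ℚ →* L s := fun s i => PushoutI.of (φ := φ s) i
  refine ⟨ιW false (oL false false px), ιW false (oL false false py), ιW false (oL false true py),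
    ιW true (oL true false px), ?_, ?_, ?_, ?_, ?_⟩
  · -- B⁻¹ A B = A²  in L false, factor false
    rw [← map_inv, ← map_mul, ← map_mul, of_conj, map_pow]
  · -- C⁻¹ B C = B² : B = of false y = of true x (glue of pattern false), C = of true y
    have hB : oL false false py = oL false true px := of_glue_eq false
    rw [hB, ← map_inv, ← map_mul, ← map_mul, of_conj, map_pow]
  · -- D⁻¹ C D = C² : C = ιW false (of true y) = ιW true (of true x) (amalgamation along ψ, letter true),
    -- D = ιW true (of false x) = ιW true (of true y) (glue of pattern true)
    have hC : ιW false (oL false true py) = ιW true (oL true true px) := by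
      have e0 : oL false true py = ψ false (CoprodI.of (i := true) (Multiplicative.ofAdd 1)) := by
        rw [ψ_of]; simp [gen, letter, oL]
      have e1 : oL true true px = ψ true (CoprodI.of (i := true) (Multiplicative.ofAdd 1)) := by
        rw [ψ_of]; simp [gen, letter, oL]
      rw [e0, e1, PushoutI.of_apply_eq_base, PushoutI.of_apply_eq_base]
    have hD : oL true false px = oL true true py := of_glue_eq true
    rw [hC, hD, ← map_inv, ← map_mul, ← map_mul, of_conj, map_pow]
  · -- A⁻¹ D A = D² : A = ιW false (of false x) = ιW true (of false y), D = ιW true (of false x)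
    have hA : ιW false (oL false false px) = ιW true (oL true false py) := by
      have e0 : oL false false px = ψ false (CoprodI.of (i := false) (Multiplicative.ofAdd 1)) := by
        rw [ψ_of]; simp [gen, letter, oL]
      have e1 : oL true false py = ψ true (CoprodI.of (i := false) (Multiplicative.ofAdd 1)) := by
        rw [ψ_of]; simp [gen, letter, oL]
      rw [e0, e1, PushoutI.of_apply_eq_base, PushoutI.of_apply_eq_base]
    rw [hA, ← map_inv, ← map_mul, ← map_mul, of_conj, map_pow]
  · -- A ≠ 1
    intro hA
    have h1 : oL false false px = 1 := (of_L_injective false) (by rw [map_one]; exact hA)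
    have h2 : px = 1 := (PushoutI.of_injective (φ_injective false) false) (by rw [map_one]; exact h1)
    have := congrArg (fun σ : Perm ℚ => σ 0) h2
    have h3 : (px ^ (1 : ℤ)) 0 = 0 := by simpa using this
    rw [px_zpow_apply] at h3
    norm_num at h3

end HigmanGroup

end Literature.GroupTheory.CombinatorialGroupTheory
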